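import Summits.QuantumFields.YangMills.Theorems.AtomicCalibrationRGridPartition
import Summits.QuantumFields.YangMills.Theorems.AtomicCalibrationRProductBump
import Summits.QuantumFields.YangMills.Theorems.AtomicCalibrationRGevreyProduct

/-!
# AtomicCalibrationR (stmt-QuantumFields-28169), E2 `stub_offDiagonalWhitney` — budget-free (Gevrey) rate of the grid bumps
# (roadmap v3 item G.3, first instance; prover w4 g22, free hands)

`BandBump.exists_gridBump_rate` gives `‖D^m gridBump‖ ≤ (A·4n/h)^m` for `m ≤ N'` with `A = A(N')` from compactness — useless when
the budget is `N'·n`.  With an explicit Gevrey bound on the profile, `‖φ^{(j)}‖ ≤ C₀ C₁^j (j!)^s` (`C₀ ≥ 1`, `‖φ‖ ≤ 1`), the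
factorial-rate multinomial bound (`GevreyProduct`) yields a bound for ALL orders with budget-independent constants:

* `norm_iteratedFDeriv_gridBump_le_gevrey` — `‖D^m (gridBump φ n h c) z‖ ≤ (m!)^s (4n C₀ C₁ / h)^m` for every `m`, `0 < h`.

No stub/crux/rung/summit is closed; nothing here touches Yang–Mills; the YM mass gap is NOT proved. [folklore]
-/

set_option autoImplicit false

noncomputable section

open scoped BigOperators ContDiff
open Set
open Summit.QuantumFields.YangMills.Cruxes.AtomicCalibrationR.GridPartition (gridBump)
open Summit.QuantumFields.YangMills.Cruxes.AtomicCalibrationR.ProductBump (norm_iteratedFDeriv_factor_le)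
open Summit.QuantumFields.YangMills.Cruxes.AtomicCalibrationR.GevreyProduct (norm_iteratedFDeriv_prod_le_factorial_pow)

namespace Summit.QuantumFields.YangMills.Cruxes.AtomicCalibrationR.GevreyGridBump

/-- **Budget-free rate of the grid bumps** under a Gevrey bound on the profile. [folklore] -/
theorem norm_iteratedFDeriv_gridBump_le_gevrey {ρ : ℝ → ℝ} (hρ : ContDiff ℝ ∞ ρ) (hρ1 : ∀ t : ℝ, ‖ρ t‖ ≤ 1) {C₀ C₁ : ℝ}
    (hC₀ : 1 ≤ C₀) (hC₁ : 0 ≤ C₁) {s : ℕ}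
    (hD : ∀ (j : ℕ) (t : ℝ), ‖iteratedFDeriv ℝ j ρ t‖ ≤ C₀ * C₁ ^ j * ((Nat.factorial j : ℕ) : ℝ) ^ s)
    (n : ℕ) {h : ℝ} (hh : 0 < h) (c : Fin n × Fin 4 → ℤ) (m : ℕ) (z : Fin n → EuclideanSpace ℝ (Fin 4)) :
    ‖iteratedFDeriv ℝ m (gridBump ρ n h c) z‖ ≤ ((Nat.factorial m : ℕ) : ℝ) ^ s * (4 * n * (C₀ * C₁ / h)) ^ m := by
  classical
  have hC₀0 : 0 ≤ C₀ := by linarith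
  -- per-factor Gevrey rates
  have hb : ∀ q ∈ (Finset.univ : Finset (Fin n × Fin 4)), ∀ j : ℕ, j ≤ m →
      ‖iteratedFDeriv ℝ j (fun z : Fin n → EuclideanSpace ℝ (Fin 4) => ρ (z q.1 q.2 / h - c q)) z‖ ≤
        ((Nat.factorial j : ℕ) : ℝ) ^ s * (C₀ * C₁ / h) ^ j := by
    intro q _ j _
    rcases Nat.eq_zero_or_pos j with rfl | hj
    · rw [norm_iteratedFDeriv_zero, pow_zero, Nat.factorial_zero, Nat.cast_one, one_pow, mul_one]
      exact hρ1 _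
    · have h1 := norm_iteratedFDeriv_factor_le ρ hρ (D := fun j => C₀ * C₁ ^ j * ((Nat.factorial j : ℕ) : ℝ) ^ s) hD q.1 q.2 hh
        (c q : ℝ) j z
      refine h1.trans ?_
      rw [div_pow, mul_div_assoc']
      refine div_le_div_of_nonneg_right ?_ (pow_pos hh j).le
      have hC₀j : C₀ ≤ C₀ ^ j := le_self_pow₀ hC₀ (by omega)
      calc C₀ * C₁ ^ j * ((Nat.factorial j : ℕ) : ℝ) ^ s ≤ C₀ ^ j * C₁ ^ j * ((Nat.factorial j : ℕ) : ℝ) ^ s := by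
            refine mul_le_mul_of_nonneg_right (mul_le_mul_of_nonneg_right hC₀j (pow_nonneg hC₁ j)) (by positivity)
        _ = ((Nat.factorial j : ℕ) : ℝ) ^ s * (C₀ * C₁) ^ j := by rw [mul_pow]; ring
  have hf : ∀ q ∈ (Finset.univ : Finset (Fin n × Fin 4)),
      ContDiff ℝ ∞ (fun z : Fin n → EuclideanSpace ℝ (Fin 4) => ρ (z q.1 q.2 / h - c q)) := by
    intro q _
    have hcoord : ContDiff ℝ ∞ (fun z : Fin n → EuclideanSpace ℝ (Fin 4) => z q.1 q.2) :=
      ((EuclideanSpace.proj q.2 : EuclideanSpace ℝ (Fin 4) →L[ℝ] ℝ).comp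
        (ContinuousLinearMap.proj q.1 : (Fin n → EuclideanSpace ℝ (Fin 4)) →L[ℝ] EuclideanSpace ℝ (Fin 4))).contDiff
    exact hρ.comp ((hcoord.div_const h).sub contDiff_const)
  have hprod := norm_iteratedFDeriv_prod_le_factorial_pow (E := Fin n → EuclideanSpace ℝ (Fin 4))
    (Finset.univ : Finset (Fin n × Fin 4))
    (fun (q : Fin n × Fin 4) (z : Fin n → EuclideanSpace ℝ (Fin 4)) => ρ (z q.1 q.2 / h - c q)) hf
    (M := C₀ * C₁ / h) (by positivity) s m z hb
  have hfun : gridBump ρ n h c = fun z : Fin n → EuclideanSpace ℝ (Fin 4) =>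
      ∏ q ∈ (Finset.univ : Finset (Fin n × Fin 4)), ρ (z q.1 q.2 / h - c q) := rfl
  rw [hfun]
  refine hprod.trans (le_of_eq ?_)
  rw [Finset.card_univ, Fintype.card_prod, Fintype.card_fin, Fintype.card_fin]
  push_cast
  ring

end Summit.QuantumFields.YangMills.Cruxes.AtomicCalibrationR.GevreyGridBump

end
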